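import Summits.BirchSwinnertonDyer.Rank1Residual.GaloisImage.KummerConditionUnramifiedOfRootable
import Summits.BirchSwinnertonDyer.Rank1Residual.X11b.BDPRouteNonsingularTorsionDivisible
import Literature.NumberTheory.EllipticCurves.NonsplitProofs
import Literature.RingTheory.DiscreteValuationRing.AdicCompletionResidueField
import HarnessLib

/-!
# (ROOT) at a NON-SPLIT multiplicative place `v ∤ p`, `p` odd: `E(K_v)[p^∞]` lies in the divisible
# part of `E(K_v^nr)[p^∞]`; hence `H¹_ur(K_v, E[p^∞]) = 0` and `𝓛_v(E[p^k]) = H¹_ur(K_v, E[p^k])`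
# with NO hypothesis on `ord_v Δ` (team n1011, seat p10 GEN 14 — TOOL)

HONEST FRAMING (cell `b2b-bsdres-*`, team n1011, verbatim): prove what is provable now; shrink each
hard class to its core with data; no claim beyond stated classes. Research route; TOOL theorems
only — no definition, no named fact, nothing booked, no residual-map mark moved, no class closed.
Not a discharge of the registered fact A46 (`Fisher2016.thm44_selmerLocalKer_iff_of_nonsplit_good`;
its `v ∣ p` disjunct stays), not a re-key of any record (consumers' lineages), closes no row, no §K.2 letter
(cell row T-ROOT, lead R5-132).

## What

At a multiplicative place `v ∤ p` the inertia invariants `N = E[p^∞]^{I_v}` are an extension of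
`ℤ/p^e` (`p^e ‖ ord_v Δ_min = #Φ_v(k̄)`) by the divisible group `μ_{p^∞}`-part `E₀(K_v^nr)[p^∞]`;
Gross–Parson's hypothesis `p ∤ #Φ_v(k̄)` (row T-GP6, GEN 11) makes `N` divisible.  When the reduction
is NON-SPLIT and `p` is odd, no hypothesis is needed: Frobenius acts by `−1` on `Φ_v(k̄)`, so
`Φ_v(k_v)` has order `c_v ∈ {1, 2}` (Tate's algorithm Step 2, tree theorem
`localTamagawaNumber_of_hasNonsplitMultiplicativeReductionAt_holds`) and every `K_v`-RATIONAL
`p`-power torsion point already lies in `E₀`, whose `p`-power torsion is `p`-divisible inside `E₀`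
over `K̄_v` (X11b route p2's `localDivisible_nonsingular_torsion`, Hensel on the node).  In the
currency of the tree (sub-cell multr1-p2's `nonsingularPart` `M₀ ≤ E(K̄)^{I_v}`, its index lemma
`relIndex_nonsingularPart_ker_dvd_localTamagawaNumber` and divisibility transport
`exists_nsmul_eq_of_mem_nonsingularPart_of_localDivisible`):

* `localTamagawaNumber_dvd_two_of_nonsplit` — `c_v ∣ 2` at a non-split multiplicative place;
* **`rootable_adicCompletionPrime_of_nonsplit`** / **`rootable_of_nonsplit`** — (ROOT): every
  `D_v`-fixed (`Γ_{K_v}`-fixed) point of `E[p^∞]` has `I_v`-fixed `p^k`-th roots for every `k`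
  (`v ∤ p`, `p` odd, `v` non-split multiplicative; any number field, any `ord_v Δ`);
* consequences via the (ROOT) files: `unramifiedSubgroup_primary_eq_bot_of_nonsplit`
  (`H¹_ur(K_v, E[p^∞]) = 0`), `kummerLocalConditionAt_eq_unramifiedSubgroup_of_nonsplit[_prime]`,
  `kummerSelmerStructure_inr_eq_unramifiedSubgroup_of_nonsplit[_prime]` — the Kummer condition IS
  the unramified condition at such places (compare Fisher 2016 Thm. 4.4, whose printed proof uses the
  Tate parametrisation over the unramified quadratic extension; here: Néron-component road, no Tate
  curve, unconditional).

References: [SilvermanATAEC1994] IV.9.4 Step 2 (PDF p. 344), Cor. IV.9.2; [SilvermanAEC2009]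
VII.2.1, VII.3.1, VII.6.1; [GreenbergLNM1716] §3 Lemma 3.3 (LNM pp. 73–74; author's
CIME preprint pp. 23–24), §4 proof of Thm. 4.1 (LNM p. 86; preprint p. 36); [MilneADT2006] I
Prop. 3.8; [Fisher2016Visualizing7] Thm. 4.4 (p. 106); [GrossParson2011] Lemma 6 (p. 226).
-/

noncomputable section

open scoped Classical NNReal

open NumberField IsDedekindDomain Field IsDedekindDomain.HeightOneSpectrum WeierstrassCurve
open Literature.NumberTheory.EllipticCurves Literature.NumberTheory.EllipticCurves.GreenbergSelmer
open Literature.NumberTheory.GaloisRepresentations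
open Literature.NumberTheory.GaloisRepresentations.IsNonarchimedeanLocalField
open Literature.NumberTheory.GaloisRepresentations.DiscreteGaloisModule (unramifiedSubgroup)

namespace Summit.BirchSwinnertonDyer.Rank1Residual.GaloisImage.InertiaDivisible

open Summit.BirchSwinnertonDyer.Rank1Residual.X11b.AcSelmer
open Summit.BirchSwinnertonDyer.Rank1Residual.X11b.LocBridge

variable {K : Type} [Field K] [NumberField K] (W : WeierstrassCurve K) [W.IsElliptic] (p : ℕ)
  [Fact p.Prime]

/-! ## §1. `c_v ∣ 2` at a non-split multiplicative place -/

omit [Fact p.Prime] in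
/-- **At a NON-SPLIT multiplicative place the local Tamagawa number divides `2`** (`c_v = 2` if
`ord_v Δ_min` is even, `1` if odd: Tate's algorithm Step 2, tree theorem
`localTamagawaNumber_of_hasNonsplitMultiplicativeReductionAt_holds`; the residue field of `K_v` is
finite). [cite: SilvermanATAEC1994, IV.9.4 Step 2 (PDF p. 344)] -/
theorem localTamagawaNumber_dvd_two_of_nonsplit {v : HeightOneSpectrum (𝓞 K)}
    (hmult : W.HasMultiplicativeReductionAt v) (hns : ¬ W.HasSplitMultiplicativeReductionAt v) :
    (W.baseChange (v.adicCompletion K)).localTamagawaNumber (v.adicCompletionIntegers K) ∣ 2 := by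
  haveI : Finite (IsLocalRing.ResidueField (v.adicCompletionIntegers K)) :=
    IsDedekindDomain.HeightOneSpectrum.finite_residueField_adicCompletionIntegers K v
  rw [localTamagawaNumber_of_hasNonsplitMultiplicativeReductionAt_holds v W hmult hns]
  split_ifs
  · exact dvd_rfl
  · exact one_dvd _

/-! ## §2. (ROOT) at a non-split multiplicative `v ∤ p`, `p` odd -/

/-- **(ROOT) at a NON-SPLIT multiplicative place `v ∤ p`, `p` odd** (`𝔓₀`-form): every point of
`E[p^∞]` fixed by the decomposition group `D_{𝔓₀}` has, for every `k`, a `p^k`-th root in `E[p^∞]`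
fixed by the inertia group `I_{𝔓₀}`.  Proof, in sub-cell multr1-p2's currency: let
`M₀ = nonsingularPart ≤ E(K̄)^{I_v}` (points whose image on the minimal model over `K̄_v` has
non-singular reduction).  The point `t` is `D_v`-fixed, i.e. killed by `φ − 1`
(`inertiaSubOne_eq_zero_iff`); `[E(K̄)^{D_v} : E(K̄)^{D_v} ⊓ M₀] ∣ c_v ∣ 2`
(`relIndex_nonsingularPart_ker_dvd_localTamagawaNumber`, §1), so `2 • t ∈ M₀`, hence `t ∈ M₀` as
`t` has odd order; and `M₀[p^∞]` is `p`-divisible (`exists_nsmul_eq_of_mem_nonsingularPart_of_localDivisible`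
fed by `localDivisible_nonsingular_torsion`), so `t` has `p^k`-th roots in `M₀ ⊆ E(K̄)^{I_v}`.
[cite: SilvermanATAEC1994, IV.9.4 Step 2 (PDF p. 344) and Cor. IV.9.2(d) (PDF p. 340)]
[cite: GreenbergLNM1716, §3 Lemma 3.3 (LNM p. 73; CIME preprint p. 23) and §4 proof of Thm. 4.1 (LNM p. 86; preprint p. 36)]
[cite: SilvermanAEC2009, VII.§2 Prop. 2.1 and Prop. VII.3.1] -/
theorem rootable_adicCompletionPrime_of_nonsplit {v : HeightOneSpectrum (𝓞 K)}
    (hpv : (p : 𝓞 K) ∉ v.asIdeal) (hp2 : p ≠ 2)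
    (hmult : W.HasMultiplicativeReductionAt v) (hns : ¬ W.HasSplitMultiplicativeReductionAt v)
    (t : W.geomPrimaryTorsion p)
    (ht : ∀ d ∈ (adicCompletionPrime K v).decompositionSubgroup (absoluteGaloisGroup K), d • t = t)
    (k : ℕ) :
    ∃ s : W.geomPrimaryTorsion p,
      (∀ i ∈ (adicCompletionPrime K v).inertia (absoluteGaloisGroup K), i • s = s) ∧ p ^ k • s = t := by
  have hpp : p.Prime := Fact.out
  -- local data (as in `natCard_localKer_le_pow_padicValNat_localTamagawaNumber_of_localDivisible`)
  obtain ⟨w, hw⟩ := v.exists_spectralValuation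
  obtain ⟨𝔐, h𝔐⟩ := v.localPrimesAbove_nonempty
  have hint := WeierstrassCurve.isIntegral_spectralValuation_baseChange hw
    (W.localMinimalIntegralModel v)
  obtain ⟨W₀, hW₀⟩ := hint.integral
  obtain ⟨C, hC⟩ := W.exists_variableChange_eq_localMinimalIntegralModel v
  obtain ⟨Φ, hΦ⟩ := W.exists_addEquiv_localPoints_of_smul_eq v hC
  have hpu : IsUnit ((p : ℕ) : v.adicCompletionIntegers K) := by
    have h := isUnit_algebraMap_adicCompletionIntegers K v hpv
    rwa [map_natCast] at h
  obtain ⟨φ, hφ⟩ := exists_isArithFrobAt_of_mem_primesAbove_holds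
    (adicCompletionPrime_mem_primesAbove K v)
  have hφD : φ ∈ decomp v :=
    (decomp_eq_decompositionSubgroup_adicCompletionPrime v).symm ▸ hφ.mem_stabilizer
  -- the point `P₀ = t` of `Fix = E(K̄)^{I_v}`; it is `D_v`-fixed
  have htI : ∀ i ∈ (adicCompletionPrime K v).inertia (absoluteGaloisGroup K),
      i • (t : W.geomPoints) = t := by
    intro i hi
    have hiD : i ∈ (adicCompletionPrime K v).decompositionSubgroup (absoluteGaloisGroup K) := by
      rw [← decomp_eq_decompositionSubgroup_adicCompletionPrime v]
      exact inertia_adicCompletionPrime_le_decomp v hi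
    rw [← primaryComponent.coe_smul, ht i hiD]
  let P₀ : FixedPoints.addSubgroup ↥((adicCompletionPrime K v).inertia (absoluteGaloisGroup K))
      W.geomPoints := ⟨(t : W.geomPoints), fun i ↦ htI i i.2⟩
  have hP₀coe : ((P₀ : FixedPoints.addSubgroup ↥((adicCompletionPrime K v).inertia
      (absoluteGaloisGroup K)) W.geomPoints) : W.geomPoints) = (t : W.geomPoints) := rfl
  have hP₀D : inertiaSubOne W.geomPoints φ hφD P₀ = 0 := by
    rw [inertiaSubOne_eq_zero_iff W hφ hφD]
    intro x hx
    rw [decomp_eq_decompositionSubgroup_adicCompletionPrime v] at hx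
    rw [hP₀coe, ← primaryComponent.coe_smul, ht x hx]
  -- `2 • P₀ ∈ M₀`
  have hdvd2 : (nonsingularPart W hW₀ Φ).relIndex (inertiaSubOne W.geomPoints φ hφD).ker ∣ 2 :=
    (relIndex_nonsingularPart_ker_dvd_localTamagawaNumber hw hW₀ hΦ hφ hφD).trans
      (localTamagawaNumber_dvd_two_of_nonsplit W hmult hns)
  have h2P₀ : (2 : ℕ) • P₀ ∈ nonsingularPart W hW₀ Φ := by
    have hmem : ((nonsingularPart W hW₀ Φ).addSubgroupOf (inertiaSubOne W.geomPoints φ hφD).ker).index •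
        (⟨P₀, hP₀D⟩ : (inertiaSubOne W.geomPoints φ hφD).ker) ∈
        (nonsingularPart W hW₀ Φ).addSubgroupOf (inertiaSubOne W.geomPoints φ hφD).ker :=
      AddSubgroup.nsmul_index_mem _ _
    rw [AddSubgroup.mem_addSubgroupOf, AddSubgroup.coe_nsmul] at hmem
    obtain ⟨m, hm⟩ := hdvd2
    have e : (2 : ℕ) • P₀ =
        m • ((nonsingularPart W hW₀ Φ).relIndex (inertiaSubOne W.geomPoints φ hφD).ker • P₀) := by
      rw [smul_smul, mul_comm, ← hm]
    rw [e]
    exact AddSubgroup.nsmul_mem _ hmem m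
  -- `P₀ ∈ M₀`: `t` has odd (`p`-power) order
  obtain ⟨j, hj⟩ := (AddCommGroup.mem_primaryComponent).mp t.2
  have hP₀j : p ^ j • P₀ = 0 :=
    Subtype.ext (by rw [AddSubmonoidClass.coe_nsmul, ZeroMemClass.coe_zero, hP₀coe]; exact hj)
  obtain ⟨a, ha⟩ : Odd (p ^ j) := (hpp.odd_of_ne_two hp2).pow
  have hP₀M₀ : P₀ ∈ nonsingularPart W hW₀ Φ := by
    have e : (a + 1) • ((2 : ℕ) • P₀) = P₀ := by
      rw [smul_smul, show (a + 1) * 2 = p ^ j + 1 by omega, add_nsmul, hP₀j, one_nsmul, zero_add]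
    rw [← e]
    exact AddSubgroup.nsmul_mem _ h2P₀ _
  have hP₀prim : P₀ ∈ AddCommGroup.primaryComponent
      ↥(FixedPoints.addSubgroup ↥((adicCompletionPrime K v).inertia (absoluteGaloisGroup K))
        W.geomPoints) p :=
    (AddCommGroup.mem_primaryComponent).mpr ⟨j, hP₀j⟩
  -- `M₀[p^∞]` is `p`-divisible: iterate
  have hdivM₀ := exists_nsmul_eq_of_mem_nonsingularPart_of_localDivisible hw hW₀ hΦ h𝔐 hpu
    (fun Q hfix hQ hk ↦ localDivisible_nonsingular_torsion W v hpv w hw 𝔐 h𝔐 Q hfix hQ hk)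
  have key : ∀ k : ℕ, ∃ b : FixedPoints.addSubgroup
      ↥((adicCompletionPrime K v).inertia (absoluteGaloisGroup K)) W.geomPoints,
      b ∈ AddCommGroup.primaryComponent _ p ∧ b ∈ nonsingularPart W hW₀ Φ ∧ p ^ k • b = P₀ := by
    intro k
    induction k with
    | zero => exact ⟨P₀, hP₀prim, hP₀M₀, by rw [pow_zero, one_nsmul]⟩
    | succ k ih =>
      obtain ⟨b, hbprim, hbM₀, hb⟩ := ih
      obtain ⟨b', hb'prim, hb'M₀, hb'⟩ := hdivM₀ b hbprim hbM₀
      exact ⟨b', hb'prim, hb'M₀, by rw [pow_succ, ← smul_smul, hb', hb]⟩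
  obtain ⟨b, hbprim, -, hb⟩ := key k
  obtain ⟨k', hk'⟩ := (AddCommGroup.mem_primaryComponent).mp hbprim
  have hk'' : p ^ k' • (b : W.geomPoints) = 0 := by
    have h := congrArg (fun z : FixedPoints.addSubgroup
      ↥((adicCompletionPrime K v).inertia (absoluteGaloisGroup K)) W.geomPoints ↦
        (z : W.geomPoints)) hk'
    simpa only [AddSubmonoidClass.coe_nsmul, ZeroMemClass.coe_zero] using h
  refine ⟨⟨(b : W.geomPoints), (AddCommGroup.mem_primaryComponent).mpr ⟨k', hk''⟩⟩,
    fun i hi ↦ Subtype.ext ?_, Subtype.ext ?_⟩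
  · rw [primaryComponent.coe_smul]
    exact b.2 ⟨i, hi⟩
  · have h := congrArg (fun z : FixedPoints.addSubgroup
      ↥((adicCompletionPrime K v).inertia (absoluteGaloisGroup K)) W.geomPoints ↦
        (z : W.geomPoints)) hb
    simpa only [AddSubmonoidClass.coe_nsmul] using h

/-- **(ROOT) at a NON-SPLIT multiplicative place `v ∤ p`, `p` odd** (local form): every point of
`E[p^∞]` fixed by `Γ_{K_v}` (acting through `res : Γ_{K_v} → Γ_K`) has, for every `k`, a `p^k`-th
root fixed by the local inertia group `absInertia K_v` (`D_{𝔓₀} = res Γ_{K_v}`, `I_{𝔓₀} = res I_{K_v}`).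
[cite: SilvermanATAEC1994, IV.9.4 Step 2 (PDF p. 344) and Cor. IV.9.2(d) (PDF p. 340)]
[cite: NeukirchANT1999, Ch. II §9 Prop. (9.6)] -/
theorem rootable_of_nonsplit {v : HeightOneSpectrum (𝓞 K)}
    (hpv : (p : 𝓞 K) ∉ v.asIdeal) (hp2 : p ≠ 2)
    (hmult : W.HasMultiplicativeReductionAt v) (hns : ¬ W.HasSplitMultiplicativeReductionAt v)
    (t : W.geomPrimaryTorsion p)
    (ht : ∀ σ : absoluteGaloisGroup (v.adicCompletion K),
      absGaloisRestrict K (v.adicCompletion K) σ • t = t) (k : ℕ) :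
    ∃ s : W.geomPrimaryTorsion p,
      (∀ τ ∈ absInertia (v.adicCompletion K), absGaloisRestrict K (v.adicCompletion K) τ • s = s) ∧
        p ^ k • s = t := by
  have ht' : ∀ d ∈ (adicCompletionPrime K v).decompositionSubgroup (absoluteGaloisGroup K),
      d • t = t := by
    intro d hd
    rw [decompositionSubgroup_adicCompletionPrime_eq_range] at hd
    obtain ⟨σ, rfl⟩ := hd
    exact ht σ
  obtain ⟨s, hs, hps⟩ := rootable_adicCompletionPrime_of_nonsplit W p hpv hp2 hmult hns t ht' k
  exact ⟨s, (forall_inertia_adicCompletionPrime_smul_eq_iff W p v s).mp hs, hps⟩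

/-! ## §3. Consequences: `H¹_ur(K_v, E[p^∞]) = 0` and Kummer = unramified at non-split places -/

/-- **`H¹_ur(K_v, E[p^∞]) = 0` at a NON-SPLIT multiplicative `v ∤ p`, `p` odd** — no hypothesis on
`ord_v Δ` (at a split place this fails as soon as `p ∣ ord_v Δ`).
[cite: MilneADT2006, Ch. I Prop. 3.8] [cite: GreenbergLNM1716, §3 Lemma 3.3 and its proof (LNM pp. 73–74; CIME preprint pp. 23–24)] -/
theorem unramifiedSubgroup_primary_eq_bot_of_nonsplit {v : HeightOneSpectrum (𝓞 K)}
    (hpv : (p : 𝓞 K) ∉ v.asIdeal) (hp2 : p ≠ 2)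
    (hmult : W.HasMultiplicativeReductionAt v) (hns : ¬ W.HasSplitMultiplicativeReductionAt v) :
    DiscreteGaloisModule.unramifiedSubgroup
      (GaloisRep.restrictField (v.adicCompletion K) (primaryGaloisModule W p)) 1 = ⊥ :=
  unramifiedSubgroup_primary_eq_bot_of_rootable W p hpv (rootable_of_nonsplit W p hpv hp2 hmult hns)

/-- **`𝓛_v(E[p^k]) = H¹_ur(K_v, E[p^k])` at a NON-SPLIT multiplicative `v ∤ p`, `p` odd**
(`kummerLocalConditionAt` currency; no hypothesis on `ord_v Δ`, any number field).
[cite: MilneADT2006, Ch. I Prop. 3.8] [cite: Fisher2016Visualizing7, Thm. 4.4 (p. 106)] -/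
theorem kummerLocalConditionAt_eq_unramifiedSubgroup_of_nonsplit {v : HeightOneSpectrum (𝓞 K)}
    (hpv : (p : 𝓞 K) ∉ v.asIdeal) (hp2 : p ≠ 2)
    (hmult : W.HasMultiplicativeReductionAt v) (hns : ¬ W.HasSplitMultiplicativeReductionAt v)
    (k : ℕ) :
    W.kummerLocalConditionAt ((p ^ k : ℕ) : ℤ) (v.adicCompletion K) =
      unramifiedSubgroup (GaloisRep.restrictField (v.adicCompletion K)
        (W.torsionGaloisModule ((p ^ k : ℕ) : ℤ))) 1 :=
  kummerLocalConditionAt_eq_unramifiedSubgroup_of_rootable W p k hpv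
    (rootable_of_nonsplit W p hpv hp2 hmult hns)

/-- Prime level: `𝓛_v(E[p]) = H¹_ur(K_v, E[p])` at a NON-SPLIT multiplicative `v ∤ p`, `p` odd.
[cite: MilneADT2006, Ch. I Prop. 3.8] [cite: Fisher2016Visualizing7, Thm. 4.4 (p. 106)] -/
theorem kummerLocalConditionAt_eq_unramifiedSubgroup_of_nonsplit_prime {v : HeightOneSpectrum (𝓞 K)}
    (hpv : (p : 𝓞 K) ∉ v.asIdeal) (hp2 : p ≠ 2)
    (hmult : W.HasMultiplicativeReductionAt v) (hns : ¬ W.HasSplitMultiplicativeReductionAt v) :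
    W.kummerLocalConditionAt (p : ℤ) (v.adicCompletion K) =
      unramifiedSubgroup (GaloisRep.restrictField (v.adicCompletion K)
        (W.torsionGaloisModule (p : ℤ))) 1 :=
  kummerLocalConditionAt_eq_unramifiedSubgroup_of_rootable_prime W p hpv
    (rootable_of_nonsplit W p hpv hp2 hmult hns)

/-- Selmer-structure currency: `𝓛_v^{Kummer}(E[p^k]) = H¹_ur(K_v, E[p^k])` at a NON-SPLIT
multiplicative `v ∤ p`, `p` odd. [cite: MilneADT2006, Ch. I Prop. 3.8] -/
theorem kummerSelmerStructure_inr_eq_unramifiedSubgroup_of_nonsplit {v : HeightOneSpectrum (𝓞 K)}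
    (hpv : (p : 𝓞 K) ∉ v.asIdeal) (hp2 : p ≠ 2)
    (hmult : W.HasMultiplicativeReductionAt v) (hns : ¬ W.HasSplitMultiplicativeReductionAt v)
    (k : ℕ) :
    W.kummerSelmerStructure ((p ^ k : ℕ) : ℤ) (Sum.inr v) =
      unramifiedSubgroup (GaloisRep.toLocal v (W.torsionGaloisModule ((p ^ k : ℕ) : ℤ))) 1 :=
  kummerSelmerStructure_inr_eq_unramifiedSubgroup_of_rootable W p k hpv
    (rootable_of_nonsplit W p hpv hp2 hmult hns)

/-- Selmer-structure currency, prime level: `𝓛_v^{Kummer}(E[p]) = H¹_ur(K_v, E[p])` at a NON-SPLIT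
multiplicative `v ∤ p`, `p` odd. [cite: MilneADT2006, Ch. I Prop. 3.8] -/
theorem kummerSelmerStructure_inr_eq_unramifiedSubgroup_of_nonsplit_prime
    {v : HeightOneSpectrum (𝓞 K)} (hpv : (p : 𝓞 K) ∉ v.asIdeal) (hp2 : p ≠ 2)
    (hmult : W.HasMultiplicativeReductionAt v) (hns : ¬ W.HasSplitMultiplicativeReductionAt v) :
    W.kummerSelmerStructure (p : ℤ) (Sum.inr v) =
      unramifiedSubgroup (GaloisRep.toLocal v (W.torsionGaloisModule (p : ℤ))) 1 :=
  kummerSelmerStructure_inr_eq_unramifiedSubgroup_of_rootable_prime W p hpv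
    (rootable_of_nonsplit W p hpv hp2 hmult hns)

end Summit.BirchSwinnertonDyer.Rank1Residual.GaloisImage.InertiaDivisible

end
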